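import Mathlib.Analysis.Asymptotics.AsymptoticEquivalent
import Mathlib.Analysis.SpecialFunctions.Log.Basic
import Literature.NumberTheory.Sieve.BatemanHorn
import Literature.NumberTheory.Sieve.ParityBatemanHorn
import Literature.NumberTheory.LFunctions.LogIntegral
import Literature.NumberTheory.LFunctions.PrimeIdealTheorem
import HarnessLib

/-!
# Aletheia-Zomlefer–Fukshansky–Garcia (2020): the Bateman–Horn conjecture — statement and
# convergence of the Bateman–Horn constant

Topic `Literature/NumberTheory/Sieve` (family `parity`, sub-problem `BatemanHorn`). Vendored from
S. L. Aletheia-Zomlefer, L. Fukshansky, S. R. Garcia, *The Bateman–Horn conjecture: heuristics,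
history, and applications*, Expo. Math. 38 (2020) 430–479 = arXiv:1807.08899 (bib key
`AletheiaZomleferFukshanskyGarcia2020`). All locators (sections, `Lemma 5.1.1`, `Theorem 5.4.3`,
displays `(3.6.2)`, `(5.4.4)`, …) are those of arXiv v4 (5 Apr 2019), which numbers results and
displays by subsection. (Plain-text renderings of the paper renumber the results consecutively —
"Lemma 3", "Theorem 14" —; those numbers are not used here.)

This file covers §3.6 (the statement), §4.1 (the "no fixed prime divisor" hypothesis) and §5
(convergence of the product (3.6.3) defining `C(f₁, …, f_k)`); the applications of §6–§7 are
proposed separately as `Literature/NumberTheory/Sieve/AletheiaZomleferFukshanskyGarcia2020Applications.lean`.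

## What the tree already had (not restated)

* `Literature.polyRootCountMod f p = ω_f(p)`, `Literature.NumberTheory.Sieve.HasNoFixedPrimeDivisor`, `Literature.NumberTheory.Sieve.IsBatemanHornSystem`,
  `Literature.NumberTheory.Sieve.batemanHornPartial` / `Literature.NumberTheory.Sieve.HasBatemanHornConst` / `Literature.NumberTheory.Sieve.batemanHornConst` (the ordered
  product `C(f₁,…,f_k)`, display (3.6.3) of the source), `Literature.polyPrimeCount f x = Q(f₁,…,f_k; x)`
  (display (3.6.1)) — `Literature/NumberTheory/Sieve/BatemanHorn.lean`;
* `Literature.NumberTheory.Sieve.BatemanHornAsymptotic`, `Literature.NumberTheory.Sieve.BatemanHornConjecture` (the `x/(log x)^k` form of (3.6.2);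
  the predetermined problem statement, NOT restated here) —
  `Literature/NumberTheory/Sieve/ParityBatemanHorn.lean`;
* Lemma 2.3.2 of the source (`∫₂ˣ dt/(log t)^k ∼ x/(log x)^k`) is the named fact
  `Literature.NumberTheory.LFunctions.isEquivalent_offsetLogIntegralPow` and `Li_k = Literature.offsetLogIntegralPow`
  (`Literature/NumberTheory/LFunctions/LogIntegral.lean`);
* Theorem 5.3.1 (Euler, `∑ 1/p = ∞`) is Mathlib's `Nat.Primes.not_summable_one_div`;
* Theorem 5.3.3 (prime ideal theorem) is the named fact `Literature.NumberTheory.LFunctions.NumberField.primeIdealTheorem`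
  (with the de la Vallée-Poussin error term);
* Theorem 5.4.3 (convergence of (3.6.3) under the Bateman–Horn hypotheses) is the tree's named
  fact `Literature.NumberTheory.Sieve.exists_hasBatemanHornConst` (cited there to Bateman–Horn 1962 §2); here it is only
  restated in the printed form as a theorem *derived from* that fact
  (`AZFG2020_theorem_5_4_3`), plus the converse reduction (`exists_hasBatemanHornConst_of_ne_zero`).

## Contents

* `Literature.NumberTheory.Sieve.BatemanHornAsymptoticLi` — the asymptotic (3.6.2) exactly as printed, with main term
  `C/(∏ deg fᵢ) · ∫₂ˣ dt/(log t)^k`; PROVED equivalent to the tree's `x/(log x)^k` form given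
  Lemma 2.3.2 (`batemanHornAsymptoticLi_iff`, `batemanHornConjecture_iff_li`).
* `Literature.NumberTheory.Sieve.eq_of_associated_of_leadingCoeff_pos`, `Literature.NumberTheory.Sieve.isBatemanHornSystem_iff_injective` — the
  source's hypothesis "distinct irreducible polynomials with positive leading coefficients" is
  the tree's "pairwise non-associated" (PROVED).
* `Literature.NumberTheory.Sieve.hasNoFixedPrimeDivisor_iff_forall_exists_not_dvd` — §4.1: "for each prime `p` there is
  `m` with `p ∤ f₁(m)⋯f_k(m)`" iff "`f = ∏ fᵢ` does not vanish identically modulo any prime"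
  iff `ω_f(p) < p` (PROVED).
* §5.1 Lemma 5.1.1 (products `∏ (1 + aₙ)` and sums `∑ aₙ` converge together when
  `∑ |aₙ|² < ∞`), real case — NAMED FACT `Literature.NumberTheory.Sieve.AZFG2020_lemma_5_1_1`,
  DISCHARGED at the end of the file (`AZFG2020_lemma_5_1_1_holds`, the printed proof).
* §5.3 Theorem 5.3.2 (Mertens 1874) and Theorem 5.3.4 (Mertens for number fields, Rosen 1999 /
  Lebacque 2007) — NAMED FACTS `Literature.NumberTheory.Sieve.mertens_sum_inv_primes`, `Literature.NumberTheory.Sieve.mertens_sum_inv_primeIdeals`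
  (absent from Mathlib and from the tree); §5.3 Lemma 5.3.5 — NAMED FACT
  `Literature.NumberTheory.Sieve.AZFG2020_lemma_5_3_5`.
* §5.4 Lemma 5.4.1 and the convergence (5.4.4) of `∑_p (k - ω(p))/p` in the proof of
  Theorem 5.4.3 — NAMED FACTS `Literature.NumberTheory.Sieve.AZFG2020_lemma_5_4_1`, `Literature.NumberTheory.Sieve.AZFG2020_tendsto_sum_sub_omega_div`;
  Theorem 5.4.3 in its printed form ("the product converges", i.e. to a nonzero limit) PROVED
  from the tree's fact, and conversely (`batemanHornPartial_pos`,
  `HasBatemanHornConst.pos_of_ne_zero`, `exists_hasBatemanHornConst_of_ne_zero`).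

## Design choices

* All infinite sums/products over primes are ORDERED partial sums/products over
  `Nat.primesLE x` with a `Tendsto … atTop (𝓝 _)` clause (D-SIEVE-1 of the tree), because the
  source's products are only conditionally convergent (§5.1, §5.4).
* Lemma 5.1.1 is vendored for real sequences (the case used in Theorem 5.4.3); the source states
  it for `aₙ ∈ ℂ ∖ {-1}` with a chosen branch of `log`; "the product converges" means, as in
  §5.1 of the source, that the partial products tend to a NONZERO limit.
* Lemma 5.4.1 is stated with the hypothesis "pairwise non-associated" that its proof uses
  (`gcd(fᵢ, fⱼ) = 1` in `ℚ[x]` for `i ≠ j`); with `f₁ = f₂` the printed conclusion fails.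
* (5.4.4) is stated under the full Bateman–Horn hypotheses (`IsBatemanHornSystem`): the §5.4
  preamble only says "irreducible" (and, implicitly, distinct), but an irreducible CONSTANT
  member `fᵢ = q` (allowed by `Irreducible` in `ℤ[X]`) has `ωᵢ(p) = 0` for `p ≠ q` and makes
  `∑_p (k - ω(p))/p` diverge; `IsBatemanHornSystem` excludes constants (`ω_f(q) = q`) and is
  the setting of §5 ("prohibited by the hypotheses of the Bateman–Horn conjecture", §5.1).
-/

noncomputable section

open Filter Finset Polynomial Asymptotics
open scoped Topology

namespace Literature.NumberTheory.Sieve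

/-! ### §3.6 — the conjecture with the logarithmic integral -/

section Statement

variable {ι : Type*} [Fintype ι]

/-- The Bateman–Horn asymptotic for a finite family `f : ι → ℤ[X]` exactly as printed in the
source, display (3.6.2): the ordered product `C = ∏_p (1 - 1/p)^{-k}(1 - ω_f(p)/p)` of (3.6.3)
converges and `Q(f₁,…,f_k; x) ∼ C/(∏ᵢ deg fᵢ) · ∫₂ˣ dt/(log t)^k` (`k = card ι`,
`∫₂ˣ dt/(log t)^k = offsetLogIntegralPow k x`).
[cite: AletheiaZomleferFukshanskyGarcia2020, §3.6 (3.6.2)–(3.6.3)] -/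
def BatemanHornAsymptoticLi (f : ι → ℤ[X]) : Prop :=
  ∃ C : ℝ, HasBatemanHornConst f C ∧
    (fun x : ℕ ↦ (polyPrimeCount f x : ℝ)) ~[atTop]
      fun x : ℕ ↦ C / (∏ i, ((f i).natDegree : ℝ)) * LFunctions.offsetLogIntegralPow (Fintype.card ι) x

/-- Given Lemma 2.3.2 of the source (`∫₂ˣ dt/(log t)^k ∼ x/(log x)^k`, the tree's named fact
`isEquivalent_offsetLogIntegralPow`), the printed `Li_k` form (3.6.2) of the Bateman–Horn
asymptotic is equivalent to the tree's `x/(log x)^k` form `BatemanHornAsymptotic`.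
[cite: AletheiaZomleferFukshanskyGarcia2020, §2.3 Lemma 2.3.2 and §3.6 (3.6.2)] -/
theorem batemanHornAsymptoticLi_iff (h : LFunctions.isEquivalent_offsetLogIntegralPow) (f : ι → ℤ[X]) :
    BatemanHornAsymptoticLi f ↔ BatemanHornAsymptotic f := by
  have key : ∀ c : ℝ, (fun x : ℕ ↦ c * LFunctions.offsetLogIntegralPow (Fintype.card ι) x) ~[atTop]
      fun x : ℕ ↦ c * (x : ℝ) / Real.log x ^ Fintype.card ι := by
    intro c
    have h1 := (h (Fintype.card ι)).comp_tendsto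
      (tendsto_natCast_atTop_atTop : Tendsto (Nat.cast : ℕ → ℝ) atTop atTop)
    have h2 := (IsEquivalent.refl (u := fun _ : ℕ ↦ c) (l := atTop)).mul h1
    simpa [Function.comp_def, mul_div_assoc, Pi.mul_def] using h2
  unfold BatemanHornAsymptoticLi BatemanHornAsymptotic
  exact exists_congr fun C ↦ and_congr_right fun _ ↦
    ⟨fun H ↦ H.trans (key _), fun H ↦ H.trans (key _).symm⟩

end Statement

/-- **The Bateman–Horn conjecture as printed** (§3.6, (3.6.1)–(3.6.3)): for distinct
irreducible `f₁, …, f_k ∈ ℤ[x]` with positive leading coefficients such that `f = f₁⋯f_k` does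
not vanish identically modulo any prime, `Q(f₁,…,f_k; x) ∼ C(f₁,…,f_k)/(∏ deg fᵢ) · ∫₂ˣ dt/(log t)^k`.
Given Lemma 2.3.2 this is the tree's (predetermined) `BatemanHornConjecture`, which is therefore
not restated as a second `Prop`; "distinct" = pairwise non-associated by
`isBatemanHornSystem_iff_injective`. [cite: AletheiaZomleferFukshanskyGarcia2020, §3.6 Bateman–Horn Conjecture (3.6.1)–(3.6.3)] -/
theorem batemanHornConjecture_iff_li (h : LFunctions.isEquivalent_offsetLogIntegralPow) :
    BatemanHornConjecture ↔
      ∀ (k : ℕ) (f : Fin k → ℤ[X]), IsBatemanHornSystem f → BatemanHornAsymptoticLi f :=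
  forall₃_congr fun _ f _ ↦ (batemanHornAsymptoticLi_iff h f).symm

/-! ### "Distinct" versus "pairwise non-associated" -/

/-- Two associated integer polynomials with positive leading coefficients are equal (the units
of `ℤ[X]` are `±1`). Hence the source's hypothesis "distinct irreducible polynomials with
positive leading coefficients" (§3.6) is the tree's "pairwise non-associated". [folklore] -/
theorem eq_of_associated_of_leadingCoeff_pos {f g : ℤ[X]} (hf : 0 < f.leadingCoeff)
    (hg : 0 < g.leadingCoeff) (h : Associated f g) : f = g := by
  obtain ⟨u, rfl⟩ := h
  obtain ⟨r, hr, hru⟩ := Polynomial.isUnit_iff.mp u.isUnit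
  rcases Int.isUnit_iff.mp hr with rfl | rfl
  · simp [← hru]
  · rw [← hru, leadingCoeff_mul, leadingCoeff_C] at hg
    simp only [Int.reduceNeg, mul_neg, mul_one, Left.neg_pos_iff] at hg
    linarith

/-- The Bateman–Horn hypotheses of the tree (`IsBatemanHornSystem`: irreducible, positive
leading coefficients, pairwise non-associated, no fixed prime divisor) are exactly the printed
hypotheses of §3.6 with "distinct" read literally (`f` injective).
[cite: AletheiaZomleferFukshanskyGarcia2020, §3.6 Bateman–Horn Conjecture] -/
theorem isBatemanHornSystem_iff_injective {ι : Type*} [Fintype ι] (f : ι → ℤ[X]) :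
    IsBatemanHornSystem f ↔
      (∀ i, Irreducible (f i)) ∧ (∀ i, 0 < (f i).leadingCoeff) ∧ Function.Injective f ∧
        HasNoFixedPrimeDivisor f := by
  constructor
  · rintro ⟨h1, h2, h3, h4⟩
    refine ⟨h1, h2, fun i j hij ↦ ?_, h4⟩
    by_contra hne
    exact h3 hne (hij ▸ Associated.refl _)
  · rintro ⟨h1, h2, h3, h4⟩
    exact ⟨h1, h2, fun i j hij hass ↦
      hij (h3 (eq_of_associated_of_leadingCoeff_pos (h2 i) (h2 j) hass)), h4⟩

/-! ### §4.1 — "no fixed prime divisor" -/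

section NoFixedDivisor

variable {ι : Type*} [Fintype ι]

/-- Reduction modulo `p`: `p ∣ ∏ᵢ fᵢ(n)` iff `∏ᵢ f̄ᵢ(n̄) = 0` in `ZMod p`. [folklore] -/
theorem natCast_dvd_prod_eval_iff (f : ι → ℤ[X]) (p : ℕ) (n : ℤ) :
    (p : ℤ) ∣ ∏ i, (f i).eval n ↔
      ∏ i, ((f i).map (Int.castRingHom (ZMod p))).eval (n : ZMod p) = 0 := by
  rw [← ZMod.intCast_zmod_eq_zero_iff_dvd, Int.cast_prod]
  simp only [eval_intCast_map, eq_intCast, Int.cast_id]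

/-- **§4.1 (Schinzel's hypothesis versus Bateman–Horn's).** "For each prime `p` there exists an
integer `m` such that none of `f₁(m), …, f_k(m)` is divisible by `p`" (equivalently, `p ∤ f(m)`
for `f = f₁⋯f_k`) is equivalent to "`f` does not vanish identically modulo any prime", i.e. to
the tree's `HasNoFixedPrimeDivisor f` (`ω_f(p) < p` for every prime `p`).
[cite: AletheiaZomleferFukshanskyGarcia2020, §4.1 (paragraph after Schinzel's Hypothesis H)] -/
theorem hasNoFixedPrimeDivisor_iff_forall_exists_not_dvd (f : ι → ℤ[X]) :
    HasNoFixedPrimeDivisor f ↔ ∀ p : ℕ, p.Prime → ∃ n : ℤ, ¬(p : ℤ) ∣ ∏ i, (f i).eval n := by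
  refine forall₂_congr fun p hp ↦ ?_
  have hp0 : 0 < p := hp.pos
  have hle := card_filter_le (range p) (fun n : ℕ ↦ (p : ℤ) ∣ ∏ i, (f i).eval (n : ℤ))
  have hiff := card_filter_eq_iff (s := range p)
    (p := fun n : ℕ ↦ (p : ℤ) ∣ ∏ i, (f i).eval (n : ℤ))
  rw [card_range] at hle hiff
  unfold polyRootCountMod
  rw [hle.lt_iff_ne, Ne, hiff]
  push Not
  constructor
  · rintro ⟨n, -, hn⟩
    exact ⟨n, hn⟩
  · rintro ⟨n, hn⟩
    refine ⟨(n % p).toNat, mem_range.mpr ?_, ?_⟩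
    · have := Int.emod_lt_of_pos n (by exact_mod_cast hp0 : (0 : ℤ) < p)
      omega
    · have h0 : (0 : ℤ) ≤ n % p := Int.emod_nonneg _ (by exact_mod_cast hp0.ne')
      rw [natCast_dvd_prod_eval_iff] at hn ⊢
      have hcast : ((((n % p).toNat : ℕ) : ℤ) : ZMod p) = (n : ZMod p) := by
        rw [Int.toNat_of_nonneg h0, ZMod.intCast_mod]
      rwa [hcast]

/-- In particular the hypothesis of the tree's `SchinzelHypothesisH`/`BunyakovskyConjecture`
("for every prime `p` some value is not divisible by `p`", per polynomial family) follows from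
`IsBatemanHornSystem`. [cite: AletheiaZomleferFukshanskyGarcia2020, §4.1] -/
theorem IsBatemanHornSystem.forall_exists_not_dvd {f : ι → ℤ[X]} (hf : IsBatemanHornSystem f)
    {p : ℕ} (hp : p.Prime) : ∃ n : ℤ, ¬(p : ℤ) ∣ ∏ i, (f i).eval n :=
  (hasNoFixedPrimeDivisor_iff_forall_exists_not_dvd f).mp hf.hasNoFixedPrimeDivisor p hp

end NoFixedDivisor

/-! ### §5.1 — infinite products -/

/-- **Lemma 5.1.1** of the source (real case). Let `aₙ` be real numbers with `aₙ ≠ -1` and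
`∑ |aₙ|² < ∞`. Then `∑ aₙ` and `∏ (1 + aₙ)` converge or diverge together: the ordered partial
sums `∑_{n<N} aₙ` have a limit iff the ordered partial products `∏_{n<N} (1 + aₙ)` have a
NONZERO limit (the source's meaning of "the product converges", §5.1). The source states this
for `aₙ ∈ ℂ ∖ {-1}` with a chosen branch of `log`; the real case is the one used in
Theorem 5.4.3. [cite: AletheiaZomleferFukshanskyGarcia2020, §5.1 Lemma 5.1.1] -/
def AZFG2020_lemma_5_1_1 : Prop :=
  ∀ a : ℕ → ℝ, (∀ n, a n ≠ -1) → Summable (fun n ↦ a n ^ 2) →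
    ((∃ s : ℝ, Tendsto (fun N ↦ ∑ n ∈ range N, a n) atTop (𝓝 s)) ↔
      ∃ L : ℝ, L ≠ 0 ∧ Tendsto (fun N ↦ ∏ n ∈ range N, (1 + a n)) atTop (𝓝 L))

/-! ### §5.3 — analytic prerequisites -/

/-- **Theorem 5.3.2** of the source (Mertens 1874):
`∑_{p ≤ x} 1/p = log log x + B + O(1/log x)`, `B = 0.2614972128…` the Meissel–Mertens constant.
Stated with the constants existentially quantified and the `O` made explicit for `x ≥ 2`.
Absent from Mathlib. [cite: AletheiaZomleferFukshanskyGarcia2020, §5.3 Theorem 5.3.2] -/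
def mertens_sum_inv_primes : Prop :=
  ∃ B C : ℝ, ∀ x : ℝ, 2 ≤ x →
    |∑ p ∈ Nat.primesLE ⌊x⌋₊, (1 : ℝ) / p - Real.log (Real.log x) - B| ≤ C / Real.log x

/-- **Theorem 5.3.4** of the source (Mertens' theorem for number fields; Rosen 1999, Lebacque
2007): for a number field `K` there is a constant `C_K` with
`∑_{N(𝔓) ≤ x} 1/N(𝔓) = log log x + C_K + O(1/log x)`, the sum over the nonzero prime ideals
`𝔓` of `𝓞 K` of absolute norm at most `x` (`Literature.NumberField.primeIdealsLE K x`, a finite set).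
[cite: AletheiaZomleferFukshanskyGarcia2020, §5.3 Theorem 5.3.4] -/
def mertens_sum_inv_primeIdeals : Prop :=
  ∀ (K : Type) [Field K] [NumberField K], ∃ C D : ℝ, ∀ x : ℝ, 2 ≤ x →
    |∑ P ∈ (LFunctions.NumberField.finite_primeIdealsLE K x).toFinset, (1 : ℝ) / Ideal.absNorm P -
        Real.log (Real.log x) - C| ≤ D / Real.log x

/-- **Lemma 5.3.5** of the source. Let `g ∈ ℤ[x]` be monic irreducible and `ω(p)` the number
of solutions of `g(x) ≡ 0 (mod p)`. Then `∑_p (ω(p) - 1)/p` converges (ordered partial sums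
over `p ≤ x`). (Proof in the source: Dedekind's criterion via Corollary 5.2.5, and the two
Mertens theorems 5.3.2 and 5.3.4.) [cite: AletheiaZomleferFukshanskyGarcia2020, §5.3 Lemma 5.3.5] -/
def AZFG2020_lemma_5_3_5 : Prop :=
  ∀ g : ℤ[X], g.Monic → Irreducible g →
    ∃ L : ℝ, Tendsto (fun x : ℕ ↦ ∑ p ∈ Nat.primesLE x,
      ((polyRootCountMod ![g] p : ℝ) - 1) / p) atTop (𝓝 L)

/-! ### §5.4 — convergence of the product -/

/-- **Lemma 5.4.1** of the source, display (5.4.2). For irreducible, pairwise non-associated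
`f₁, …, f_k ∈ ℤ[x]` and `f = f₁⋯f_k`: for all but finitely many primes `p`,
`ω_f(p) = ω₁(p) + ⋯ + ω_k(p)` (`ωᵢ(p)` = number of zeros of `fᵢ` in `ℤ/pℤ`). The non-association
hypothesis is implicit in the source (its proof uses `gcd(fᵢ, fⱼ) = 1` in `ℚ[x]` for `i ≠ j`;
for `f₁ = f₂ = x` the conclusion fails at every prime).
[cite: AletheiaZomleferFukshanskyGarcia2020, §5.4 Lemma 5.4.1 (5.4.2)] -/
def AZFG2020_lemma_5_4_1 : Prop :=
  ∀ (k : ℕ) (f : Fin k → ℤ[X]), (∀ i, Irreducible (f i)) →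
    (Pairwise fun i j ↦ ¬Associated (f i) (f j)) →
    {p : ℕ | p.Prime ∧ polyRootCountMod f p ≠ ∑ i, polyRootCountMod ![f i] p}.Finite

/-- Display **(5.4.4)** in the proof of Theorem 5.4.3 of the source: under the Bateman–Horn
hypotheses, `∑_p (k - ω(p))/p` converges (ordered partial sums; from Lemmas 5.3.5 and 5.4.1).
Stated under `IsBatemanHornSystem` (see the module docstring: with an irreducible constant
member the sum diverges). [cite: AletheiaZomleferFukshanskyGarcia2020, §5.4 (5.4.4)] -/
def AZFG2020_tendsto_sum_sub_omega_div : Prop :=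
  ∀ (k : ℕ) (f : Fin k → ℤ[X]), IsBatemanHornSystem f →
    ∃ L : ℝ, Tendsto (fun x : ℕ ↦ ∑ p ∈ Nat.primesLE x,
      ((k : ℝ) - polyRootCountMod f p) / p) atTop (𝓝 L)

section Positivity

variable {ι : Type*} [Fintype ι]

/-- Each factor `(1 - 1/p)^{-k}(1 - ω_f(p)/p)` of the Bateman–Horn product is positive when
`p` is a prime with `ω_f(p) < p` (§5.1: "the only way that a zero factor can appear is if
`ω_f(p) = p`"), so the partial products are positive.
[cite: AletheiaZomleferFukshanskyGarcia2020, §5.1 (first paragraph after (3.6.3) is recalled)] -/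
theorem batemanHornPartial_pos {f : ι → ℤ[X]} (hf : HasNoFixedPrimeDivisor f) (x : ℕ) :
    0 < batemanHornPartial f x := by
  unfold batemanHornPartial
  refine prod_pos fun p hp ↦ ?_
  obtain ⟨-, hp⟩ := Nat.mem_primesLE.mp hp
  have hp1 : (1 : ℝ) < p := by exact_mod_cast hp.one_lt
  have hp0 : (0 : ℝ) < p := by positivity
  refine mul_pos (pow_pos (inv_pos.mpr ?_) _) ?_
  · rw [sub_pos, div_lt_one hp0]
    exact hp1
  · rw [sub_pos, div_lt_one hp0]
    exact_mod_cast hf p hp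

/-- A limit of the Bateman–Horn partial products of a system with no fixed prime divisor is
nonnegative, hence positive as soon as it is nonzero. [folklore] -/
theorem HasBatemanHornConst.pos_of_ne_zero {f : ι → ℤ[X]} (hf : HasNoFixedPrimeDivisor f)
    {C : ℝ} (hC : HasBatemanHornConst f C) (h0 : C ≠ 0) : 0 < C :=
  lt_of_le_of_ne (ge_of_tendsto' hC fun x ↦ (batemanHornPartial_pos hf x).le) h0.symm

/-- **Theorem 5.4.3** of the source, in its printed form: under the hypotheses of the
Bateman–Horn conjecture the product (3.6.3) defining `C(f₁,…,f_k)` converges, i.e. (§5.1) its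
ordered partial products tend to a nonzero limit. (First envisioned by Bateman–Horn 1962; the
source gives the detailed proof via Lemma 5.1.1 with `a_p = (k - ω(p))/p + B(p)/p²` and
(5.4.4).) NOT a new named fact: it is the tree's fact `exists_hasBatemanHornConst`
(`Literature/NumberTheory/Sieve/BatemanHorn.lean`, there with `C > 0`), from which the printed
form follows. [cite: AletheiaZomleferFukshanskyGarcia2020, §5.4 Theorem 5.4.3] -/
theorem AZFG2020_theorem_5_4_3 (h : ∀ k : ℕ, exists_hasBatemanHornConst (ι := Fin k)) (k : ℕ)
    (f : Fin k → ℤ[X]) (hf : IsBatemanHornSystem f) : ∃ C : ℝ, C ≠ 0 ∧ HasBatemanHornConst f C :=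
  let ⟨C, hC0, hC⟩ := h k hf
  ⟨C, hC0.ne', hC⟩

/-- Conversely, the printed form of Theorem 5.4.3 (a NONZERO limit, for `Fin k`-indexed systems)
already yields the tree's fact `exists_hasBatemanHornConst` (a POSITIVE limit, over any finite
index type): reindex along `Fintype.equivFin` and use positivity of the factors
(`batemanHornPartial_pos`). So a future discharge of the source's Theorem 5.4.3 as printed
discharges the tree's fact. [cite: AletheiaZomleferFukshanskyGarcia2020, §5.4 Theorem 5.4.3 and §5.1] -/
theorem exists_hasBatemanHornConst_of_ne_zero
    (h : ∀ (k : ℕ) (f : Fin k → ℤ[X]), IsBatemanHornSystem f →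
      ∃ C : ℝ, C ≠ 0 ∧ HasBatemanHornConst f C) :
    exists_hasBatemanHornConst (ι := ι) := by
  intro f hf
  set e := (Fintype.equivFin ι).symm
  obtain ⟨C, hC0, hC⟩ := h _ (f ∘ e) ((isBatemanHornSystem_comp_equiv e f).mpr hf)
  rw [hasBatemanHornConst_comp_equiv] at hC
  exact ⟨C, hC.pos_of_ne_zero hf.hasNoFixedPrimeDivisor hC0, hC⟩

end Positivity

/-! ### §5.1 — proof of Lemma 5.1.1 (real case)

The printed proof [cite: AletheiaZomleferFukshanskyGarcia2020, §5.1 Lemma 5.1.1, proof]: for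
`|z| ≤ 1/2`, `log(1 + z) = z + z² L(z)` with `|L(z)| < 1`; since `∑ |aₙ|² < ∞` there is `N` with
`|aₙ| ≤ 1/2` for `n ≥ N`, so `∑_{n ≥ N} log(1 + aₙ) = ∑_{n ≥ N} aₙ + ∑_{n ≥ N} aₙ² L(aₙ)` with the
last series absolutely convergent; hence `∑ aₙ` converges iff `∑ log(1 + aₙ)` converges iff
`∏ (1 + aₙ)` converges (to a nonzero limit). Below, the real-variable estimate
`|log(1 + x) - x| ≤ 2x²` for `x ≥ -1/2` (from `1 - 1/y ≤ log y ≤ y - 1`) replaces the power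
series bound, and the passage between `∑ log(1 + aₙ)` and `∏ (1 + aₙ)` is `exp`/`log` continuity
(all factors `1 + aₙ`, `n ≥ N`, are positive); the first `N` factors contribute the nonzero
constant `∏_{n<N} (1 + aₙ)` (`aₙ ≠ -1`). -/

section Lemma511

/-- `|log(1 + x) - x| ≤ 2x²` for `-1/2 ≤ x` (from `1 - y⁻¹ ≤ log y ≤ y - 1` at `y = 1 + x`);
the real-variable substitute for display (5.1.2) of the source. [folklore] -/
private theorem abs_log_one_add_sub_self_le {x : ℝ} (hx : -1 / 2 ≤ x) :
    |Real.log (1 + x) - x| ≤ 2 * x ^ 2 := by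
  have h1 : 0 < 1 + x := by linarith
  have hupper : Real.log (1 + x) ≤ x := by linarith [Real.log_le_sub_one_of_pos h1]
  have hlower : 1 - (1 + x)⁻¹ ≤ Real.log (1 + x) := Real.one_sub_inv_le_log_of_pos h1
  have hinv : x - 2 * x ^ 2 ≤ 1 - (1 + x)⁻¹ := by
    have heq : 1 - (1 + x)⁻¹ = x / (1 + x) := by
      rw [eq_div_iff h1.ne', sub_mul, inv_mul_cancel₀ h1.ne']
      ring
    rw [heq, le_div_iff₀ h1]
    nlinarith [mul_nonneg (sq_nonneg x) (show (0 : ℝ) ≤ 1 + 2 * x by linarith)]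
  rw [abs_le]
  constructor <;> nlinarith [sq_nonneg x]

/-- Lemma 5.1.1 for a real sequence with `bₙ ≥ -1/2` for ALL `n` (so every factor `1 + bₙ` is
positive) and `∑ bₙ² < ∞`: the partial sums of `bₙ` converge iff the partial products of
`1 + bₙ` converge to a nonzero limit. [cite: AletheiaZomleferFukshanskyGarcia2020, §5.1 Lemma 5.1.1, proof] -/
private theorem lemma511_of_forall_le (b : ℕ → ℝ) (hb : ∀ n, -1 / 2 ≤ b n)
    (hs : Summable fun n ↦ b n ^ 2) :
    ((∃ s : ℝ, Tendsto (fun N ↦ ∑ n ∈ range N, b n) atTop (𝓝 s)) ↔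
      ∃ L : ℝ, L ≠ 0 ∧ Tendsto (fun N ↦ ∏ n ∈ range N, (1 + b n)) atTop (𝓝 L)) := by
  -- `cₙ = log(1 + bₙ) - bₙ` is absolutely summable (`|cₙ| ≤ 2bₙ²`).
  set c : ℕ → ℝ := fun n ↦ Real.log (1 + b n) - b n with hc_def
  have hcabs : Summable fun n ↦ |c n| :=
    Summable.of_nonneg_of_le (fun n ↦ abs_nonneg _)
      (fun n ↦ abs_log_one_add_sub_self_le (hb n)) (hs.mul_left 2)
  have hcs : Summable c := summable_abs_iff.mp hcabs
  have hct : Tendsto (fun N ↦ ∑ n ∈ range N, c n) atTop (𝓝 (∑' n, c n)) :=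
    hcs.hasSum.tendsto_sum_nat
  have hpos : ∀ n, 0 < 1 + b n := fun n ↦ by linarith [hb n]
  -- Partial products are `exp` of partial sums of `bₙ + cₙ = log(1 + bₙ)`.
  have hprod : ∀ N, ∏ n ∈ range N, (1 + b n) =
      Real.exp (∑ n ∈ range N, b n + ∑ n ∈ range N, c n) := by
    intro N
    rw [← sum_add_distrib, Real.exp_sum]
    refine prod_congr rfl fun n _ ↦ ?_
    have : b n + c n = Real.log (1 + b n) := by simp only [hc_def]; ring
    rw [this, Real.exp_log (hpos n)]
  constructor
  · rintro ⟨s, hs'⟩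
    refine ⟨Real.exp (s + ∑' n, c n), Real.exp_ne_zero _, ?_⟩
    simp_rw [hprod]
    exact (Real.continuous_exp.tendsto _).comp (hs'.add hct)
  · rintro ⟨L, hL0, hL⟩
    have hlog : Tendsto (fun N ↦ ∑ n ∈ range N, b n + ∑ n ∈ range N, c n) atTop
        (𝓝 (Real.log L)) := by
      have h := hL.log hL0
      simp_rw [hprod, Real.log_exp] at h
      exact h
    refine ⟨Real.log L - ∑' n, c n, ?_⟩
    have h := hlog.sub hct
    simp_rw [add_sub_cancel_right] at h
    exact h

/-- **Lemma 5.1.1 of the source, real case — discharged.** For real `aₙ ≠ -1` with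
`∑ aₙ² < ∞`, the ordered partial sums `∑_{n<N} aₙ` converge iff the ordered partial products
`∏_{n<N} (1 + aₙ)` converge to a nonzero limit. Proof as printed (§5.1): beyond some `N₀` one
has `|aₙ| ≤ 1/2`, where `log(1 + aₙ) = aₙ + O(aₙ²)` makes `∑ (log(1 + aₙ) - aₙ)` absolutely
convergent (`lemma511_of_forall_le`); the first `N₀` terms shift the sums by a constant and
multiply the products by the nonzero constant `∏_{n<N₀} (1 + aₙ)`.
[cite: AletheiaZomleferFukshanskyGarcia2020, §5.1 Lemma 5.1.1] -/
theorem AZFG2020_lemma_5_1_1_holds : AZFG2020_lemma_5_1_1 := by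
  intro a ha hs
  -- Beyond `N₀`, `aₙ² < 1/4`, hence `aₙ ≥ -1/2`.
  obtain ⟨N₀, hN₀⟩ : ∃ N₀ : ℕ, ∀ n ≥ N₀, a n ^ 2 < 1 / 4 :=
    eventually_atTop.mp (hs.tendsto_atTop_zero.eventually (gt_mem_nhds (by norm_num)))
  have hb : ∀ n, -1 / 2 ≤ a (n + N₀) := fun n ↦ by
    have := hN₀ (n + N₀) (Nat.le_add_left N₀ n)
    nlinarith
  have hbs : Summable fun n ↦ a (n + N₀) ^ 2 := (summable_nat_add_iff N₀).mpr hs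
  have core := lemma511_of_forall_le (fun n ↦ a (n + N₀)) hb hbs
  -- The head: a constant shift of the sums, a nonzero constant factor of the products.
  set S₀ : ℝ := ∑ n ∈ range N₀, a n with hS₀_def
  set P₀ : ℝ := ∏ n ∈ range N₀, (1 + a n) with hP₀_def
  have hP₀ : P₀ ≠ 0 := prod_ne_zero_iff.mpr fun n _ h ↦ ha n (by linarith)
  have hsum : ∀ N, ∑ n ∈ range (N + N₀), a n = S₀ + ∑ n ∈ range N, a (n + N₀) := fun N ↦ by
    rw [Nat.add_comm N N₀, sum_range_add]
    exact congrArg (S₀ + ·) (sum_congr rfl fun n _ ↦ by rw [Nat.add_comm N₀ n])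
  have hprod : ∀ N, ∏ n ∈ range (N + N₀), (1 + a n) = P₀ * ∏ n ∈ range N, (1 + a (n + N₀)) :=
    fun N ↦ by
    rw [Nat.add_comm N N₀, prod_range_add]
    exact congrArg (P₀ * ·) (prod_congr rfl fun n _ ↦ by rw [Nat.add_comm N₀ n])
  have e1 : (∃ s : ℝ, Tendsto (fun N ↦ ∑ n ∈ range N, a n) atTop (𝓝 s)) ↔
      ∃ s : ℝ, Tendsto (fun N ↦ ∑ n ∈ range N, a (n + N₀)) atTop (𝓝 s) := by
    constructor
    · rintro ⟨s, h⟩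
      refine ⟨s - S₀, (((tendsto_add_atTop_iff_nat N₀).mpr h).sub_const S₀).congr fun N ↦ ?_⟩
      simp only [hsum, add_sub_cancel_left]
    · rintro ⟨s, h⟩
      refine ⟨S₀ + s, (tendsto_add_atTop_iff_nat N₀).mp ((h.const_add S₀).congr fun N ↦ ?_)⟩
      simp only [hsum]
  have e2 : (∃ L : ℝ, L ≠ 0 ∧ Tendsto (fun N ↦ ∏ n ∈ range N, (1 + a n)) atTop (𝓝 L)) ↔
      ∃ L : ℝ, L ≠ 0 ∧ Tendsto (fun N ↦ ∏ n ∈ range N, (1 + a (n + N₀))) atTop (𝓝 L) := by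
    constructor
    · rintro ⟨L, hL0, h⟩
      refine ⟨L / P₀, div_ne_zero hL0 hP₀,
        (((tendsto_add_atTop_iff_nat N₀).mpr h).div_const P₀).congr fun N ↦ ?_⟩
      simp only [hprod, mul_div_cancel_left₀ _ hP₀]
    · rintro ⟨L, hL0, h⟩
      refine ⟨P₀ * L, mul_ne_zero hP₀ hL0,
        (tendsto_add_atTop_iff_nat N₀).mp ((h.const_mul P₀).congr fun N ↦ ?_)⟩
      simp only [hprod]
  rw [e1, e2]
  exact core

end Lemma511

end Literature.NumberTheory.Sieve
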